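import Literature.MathematicalPhysics.QuantumFieldTheory.Balaban1983to89.B12NearTerms321
import Literature.MathematicalPhysics.QuantumFieldTheory.Balaban1983to89.B12Ineq39

/-!
# `Balaban1983to89.B12Carve21Sect3ExpansionHyp` — [Balaban1987RG1] pp. 269–275 [PDF 21–27]: Sect. 3 «An Expansion of Terms in
# Fluctuation Field Integral, and Preliminary Analytic Extension», part 1, (3.1)–(3.25):
# THE HYPOTHESIS-FORM BUNDLE OF CARVING BLOCK 21, over the abstract normed-space carriers of the tree's Sect. 3 kernel files
# (`B12FarTerms36`, `B12Ineq39`, `B12CauchyRemainder354`, `B12NearTerms321`)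

statement-level skeleton of published theorems with citation tags; proofs where landed; nothing here is a claim about the
Yang–Mills mass gap

SOURCE.  T. Bałaban, *Renormalization group approach to lattice gauge field theories. I. Generation of effective actions in a small
field approximation and a coupling constant renormalization in four dimensions*, Commun. Math. Phys. **109** (1987) 249–301,
doi:10.1007/bf01215223 [`Balaban1987RG1`] (cell paper "B12" = [I] of the later papers; its references [12] = [Balaban1985Averaging] = B7,
[14] = [Balaban1985BackgroundPropagators] ∕ [Balaban1985RegularSpaces] = B9 ∕ B8, [15] = [Balaban1985Variational] = B11; held
`paper:balaban1987-cmp109-rg-i-small-field`, journal page = PDF page + 248).  Pages 269–275 were read for this file on the text layer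
(`lit read … --pages 21-27`; line numbers «p00NN.txt:Ln» below, NN = PDF page) and, for every display and every sentence typed or quoted
below, on the page renders `run/shared/lean/pub/pub-balaban/b2b-balaban-ref1/pages/1987-cmp109-rg-I-small-field/…-p021-x2.png`,
`…-p024-x2.png`, `…-p025-x2.png` (pp. 269, 272, 273; the text layer of the displays (3.3)–(3.25) is unusable); the displays (3.2)–(3.25)
are quoted from the render-checked verbatim docstrings of the cited in-tree modules.  STATUS of the source: published, refereed; the
series' end statement is a CLAIM UNDER ADJUDICATION by the audit cell `pub-balaban` — see `…B12`'s module docstring.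

WHY THIS FILE (cell `lit-balaban`, P6 CARVING FAN of D-0154 (3b); seat `lit-balaban-carve-02` g4, block 21 claimed under the cell lead's
RULING #8, `run/shared/lean/pub/lit-balaban/carve/STATUS.md` 2026-08-28T08:13:59Z (check-1 ACK 08:14:09Z), after blocks 34
`B14Carve34Sect2ThmsHyp` and 27 `B13Carve27Sect1LocalizationsHyp` landed and were refereed; block row 21 of `carve/BLOCKS-21-30.md` =
`carve/CARVE-LIST.md` § Block 21; rules `carve/CARVE-RULES.md` + RULING #9 (2) (standing-smallness binders displayed as
`∃ a > 0, ∀ ε, 0 < ε → ε ≤ a → …`); KEY item `stmt-QuantumFields-20543` (K2⁷ `EndpointGivenBR13SepCoPH`, the [B12]∕[B13] node whose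
conclusion is `DagBinding.EndpointExistence (…).C.toB12` over a `B12.Construction`), also-feeds `stmt-QuantumFields-20544`).  The block is
the first half of Sect. 3 — the first expansion (3.3)–(3.4) of the curly-bracket terms of (2.12), the division (3.5) into far and near
terms, the far terms (3.6)–(3.9) and their preliminary analytic extension (3.10)–(3.17), and the rewriting (3.18)–(3.25) of the near
terms — definitions, by-reference inputs from [12]∕[14]∕[15], identities and lemma-level estimates; no theorem-level statement is printed
in the range.  At statement level this stretch is IN THE TREE (cell SKELETON: 17 rows — 10 proved, 3 typed, 2 typed-existing,
2 proved-existing; 489 in-tree declarations in 59 files cite a locator in the range; CARVE-LIST § Block 21) — so, by the fan's rule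
«IN TREE = CITE, NEVER RESTATE» (CARVE-RULES §2.3), this file (a) RESTATES NOTHING: every printed statement of the block that has a
declaration is cited BY NAME below (table + census); (b) types, after a sentence-by-sentence census of pp. 269–275 against the tree, the
FIVE printed statements of the block that have no in-tree declaration — all unnumbered sentences — in hypothesis form, objects explicit,
standing smallness displayed (§1: `PkFluctuationPrinted`, `PkExtensionPrinted`, `Bound118On314Printed`, `Eps1For314Printed`,
`Ineq39SecondCasePrinted`); (c) conjoins them with the block's HYPOTHESIS-FORM in-tree statements BY NAME — (3.9) `B12Ineq39.Ineq39Printed`,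
(3.18) `B12NearTerms321.Eq318`, (3.20) `B12NearTerms321.Eq320` — into ONE bundle `Hyp` (§2) a node prover takes as `(h : Hyp …)`, with
the bookkeeping a consumer wants (§3): the radius condition of (3.15) delivers the `hmaps`∕`hΦ` inputs of the tree's (3.15)–(3.17)
theorems (`mapsTo_line_closedBall`, `differentiableOn_line`), whence (3.17) assembled from the bundle (`bound317`, `Hyp.bound317`), the
second case of (3.9) from the first (`secondCase_of_ineq39`), and the projections.  No summit statement is proved by this file; count-neutral.

## The block's SKELETON rows and their in-tree homes (cite, never restate)

| row (CARVE-LIST § 21) | print | in tree (decl of record first; then the carriers ∕ proofs around it) |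
|---|---|---|
| B12.Eq3.1 | (3.1) pp. 269–270, `𝐏^{(k)}(g_k, U_{k+1}, B) = 𝐏^{(k)}(g_k, U_{k+1}, J_{k+1}, B)` and the paragraph around it | `B12StepFromB13.TotalLeaves` (the [II]-side bundle in which «to localize this function … We will analyze this problem in one of the next sections in a general case» is delivered: `B13PkScaling`, `B13PkLocalTerms`, `B13ExpansionAnalytic`); `B12Eq213Body268.FluctData.P` (the object 𝐏^{(k)}, (2.13)); the two unnumbered CLAIMS of the paragraph (p. 269 ll. 33–36 B-analyticity + quadratic bound O(ε₁); p. 270 ll. 1–3 the extension «defined and analytic … α′₀, α′₁ … much bigger than α₀, α₁») had no declaration: typed here, §1 `PkFluctuationPrinted`, `PkExtensionPrinted` |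
| B12.Def@270 | p. 270: cubes □ = unions of 2ᵈ cubes of π_k; `1 = Σ_□ ζ_□`, `ζ_□(x) = Π_μ ζ(M⁻¹(x_μ − y_μ))`, `ζ ∈ C₀^∞((−1,1))`, `ζ = 1` on `|t| ≤ ⅓`, `ζ = 0` on `|t| ≥ ⅔` | `B12Cubes436.card_cube`; the profile WITH BODY `B12PartitionUnity270.zeta ∕ zetaCube ∕ sum_zetaCube_eq_one ∕ contDiff_zeta ∕ zeta_eq_one ∕ zeta_eq_zero`; LOCATED DEFECT of record: «ζ has derivatives up to the second order bounded by 5» is impossible with the printed plateaus (`B12PartitionUnity270.thirtySix_le_deriv2`, `zeta_not_deriv2_le_five`: sup |ζ″| ≥ 36), admissible constants `B12Profile270Witness`, `B12Profile270Bounds` |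
| B12.Eq3.2 | (3.2) p. 270 `B′ = g_kCB − hD̃(g_kCB)` | `B12Lineariz267.linearizes` (+ `p267_linearizing_change_of_variables`) |
| B12.Eq3.3-3.4 | (3.3)–(3.4) p. 270 | `B12FirstExpansion34.eq34`, `eq34_ftc`, `eq34_pairing`, `fderiv_partition`; (3.3)'s «results of Sect. G [15], and the equality (97) [12]» = the named inputs `hE`, `hrep` of `B12FarTerms36.eq36` ([15] Sect. G: `B11SectG`, `B11Prop9Model`; (97) [12]: `B7Eq92Concrete.tildIter_eq_mgauge`) |
| B12.Eq3.5 | (3.5) p. 271 `X ∩ (□̃²)ᶜ ≠ ∅, or X ⊂ □̃²` + the two sub-cases | `B12Ext436.SiteGeometry.FarLeaf`; `B12Division35.FarClass ∕ NearClass ∕ division35 ∕ sum_division35 ∕ farClass_cases ∕ farClass_first_case ∕ farClass_second_case`; `B12Sect3Closing281.farTerm_irrelevant`, `largeDomain_irrelevant` |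
| B12.Eq3.6-3.8 | (3.6)–(3.8) p. 271 | `B12FarTerms36.eq36`, `eq37`, `deriv_eq37`, `deltaH` ((3.8) WITH BODY), `hasDerivAt_farTerm`, `deriv_farTerm_eq37`, `eq37_circleIntegral` |
| B12.Eq3.9 | (3.9) p. 271 (first case `dist^{(ξ)}(X, □) ≥ M(Lʲη)⁻¹`) | `B12Ineq39.Ineq39Printed` — HYPOTHESIS-FORM, field `ineq39` of `Hyp`; kernel-derived from (190) [15]: `B12Ineq39.ineq39_of_ineq190`; «and the same for derivatives and the second order operators applied to it»: `B12Ineq39From190.ineq39_sectG_strong`; «see Proposition 9, (190) [15]»: `B11SectG.Ineq190`, `B12KernelBound422From190`; the SECOND-CASE form of (3.9) (p. 273 ll. 25–28, no exponential factors) had no declaration: §1 `Ineq39SecondCasePrinted` |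
| B12.Txt@272 | p. 272 ll. 1–5 «In the second, simpler case … exp(−δκ(Lʲη)⁻¹) directly from the bound (1.18) … Thus in both cases we have irrelevant terms» | `B12.exp_decay_split`, `B12.exp_neg_inv_le_pow`; `B12Sect3Closing281.farTerm_irrelevant_printed`, `largeDomain_irrelevant`, `sect3_remaining_irrelevant`; `B12NearTerms321.smallFactor321` |
| B12.Eq3.10-3.12 | (3.10)–(3.12) p. 272 | `B12Eq311CurrentExpansion.sub310`, `eq311`, `F311`, `eq311_current`, `eq312_scale`; «𝐅 is a local operator depending on U, ∂U, 𝐀, ∇^ξ_U𝐀 only»: `B12Eq311Locality`, `B12Eq311RemainderBound.norm_F311_le`, `B12Eq311Models`; the Landau-gauge replacement `D*D ↦ D*D + DRD* = Δ − P₁ + (lower order)`: `B12Eq311Landau.landau_replacement`, `lapπ_landau`, `lapCur_landau` |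
| B12.Eq3.13-3.14 | (3.13)–(3.14) p. 272, «there exists a constant α₂, depending on α₀ …» | `B12Membership313II.condII_expMul`, `budget313`, `condII_covD_expMul`; `B12Membership313J.jSlot_restriction_of_le` (α₂ explicit), `B12Eq313JSlot.jSlot_norm_lt`, `current_sub310_landau`; `B12Membership314.budget314`; the (3.14)-set `B12Eq44Space.space44`; «analytic … also an analytic function of 𝐀»: `B12.Eq118Analyticity263.SFHypAnalytic.analyticOnNhd_E_chart`; the closing sentence «on these spaces … (3.13) satisfies the inequality (1.18)» had no declaration (it is the bare input `hM` of `B12CauchyRemainder354.ineq317`): §1 `Bound118On314Printed` |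
| B12.Eq3.15 | (3.15) p. 273 + radius `r·max{…} = ⅓α₂` | `B12CauchyRemainder354.deriv_eq_circleIntegral_315`; `B12.Eq118Analyticity263.SFHypAnalytic.differentiableOn_E_line ∕ _affineLine` (their `hmaps` — the radius condition — PROVED here, §3 `mapsTo_line_closedBall`); the sentence «We assume also that ε₁ is so small that 𝐇_j(B(t)) satisfies (3.14) with ⅓α₂» had no declaration: §1 `Eps1For314Printed` |
| B12.Eq3.15-3.16 | (3.16) p. 273, the space | `B12RegularSpaces111.space316` (conditions (i)–(iii) `CondI ∕ CondII ∕ CondIII ∕ SatisfiesI_III`, monotonicity `B12RegularSpaces111Mono.satisfiesI_III_mono`) |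
| B12.Eq3.17 | (3.17) p. 273 | `B12CauchyRemainder354.ineq317`, `ineq317_chain`, `ineq317_printed` (parametric in the (3.9)-factor `s`, hence BOTH cases of p. 273); assembled from the bundle here: §3 `bound317`, `Hyp.bound317` |
| B12.Eq3.18-3.19 | (3.18)–(3.19) pp. 273–274 | `B12NearTerms321.Eq318` — HYPOTHESIS-FORM (input shape), field `eq318` of `Hyp`; (3.19) PROVED `B12NearTerms321.eq319`, `eq319_chart`; the cube sequence {□_n} «satisfying the conditions (1.3)–(1.6) [14] … hence □̃⁴ ⊂ □_{k+1}»: `B12Interfaces.collar_sum_lt`, `collar_fits` (located largeness restriction on M) |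
| B12.Eq3.20 | (3.20) p. 274 | `B12NearTerms321.Eq320` — HYPOTHESIS-FORM (input shape), field `eq320` of `Hyp`; `mulFn_eq_of_eq320`; (3.21) PROVED `B12NearTerms321.eq321`, `eq321_first`, `eq321_of_eq320`, `ftc_path`, `path_eq_printed`; the sentence after (3.21): `le_dist_of_tilde2_of_closure_compl_tilde3`, `smallFactor321`; (3.22) `Btilde` (WITH BODY), `eq322`; «The expression is localized in □̃⁴∖□̃³»: `support_bracket322_subset`; (3.23) `eq323` |
| B12.Def@274 | p. 274 «ζ̃_□ ∈ C₀^∞(□₀), ζ̃_□ = 1 on □̃³, ζ̃_□ = 0 outside □̃⁴» | `B12Cubes436.suppZeta_subset_box0`, `box_subset_suppZeta`; the profile WITH BODY `B12ZetaTilde274.zetaTilde ∕ zetaTilde_eq_one ∕ zetaTilde_eq_zero ∕ contDiff_zetaTilde ∕ suppZ` |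
| B12.Eq3.24-3.25 | (3.24)–(3.25) p. 275, the «slightly different way» of introducing 𝐔, 𝐉 | `B12Inv329.Recipe` (`Recipe.F`, `Inv329At`, `inv329_forall_iff`); «We will prove that it is analytic on the space U_{k+1}(□₀, (1+2β)α₀, (1+2β)α₁, α₀)»: `B12Lemma4Uses.analyticAt_E325_of_eq328 ∕ _of_eq328U` (assembled modulo (3.28), (1.19) — block 22); «This space is defined by the same conditions (i)–(iv), only … on the whole lattice T_η»: `B12RegularSpaces111.space ∕ Satisfies` (region = the whole lattice), quote of record `B12Spaces329NearBond` |

## Census of the unnumbered printed statements of pp. 269–275 (text layer `p0021.txt`–`p0027.txt`)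

* p. 269 ll. 30–36 (`p0021.txt:L30–L36`) «[𝐏^{(k)}] is an analytic function of the fluctuation field B defined on the unit lattice T₁^{(k)}.
  It is bounded by a second order polynomial in B, with coefficients of the order O(ε₁)» — CLAIM, no declaration: §1 `PkFluctuationPrinted`.
  «hence it can be treated as a small perturbation of the basic quadratic form» — heuristic, not a statement.
* p. 269 l. 37–p. 270 l. 3 (`p0021.txt:L37`–`p0022.txt:L4`) «it has a straightforwardly defined extension 𝐏^{(k)}(g_k, 𝐔, 𝐉, B) such, that
  (3.1) … The function 𝐏^{(k)}(g_k, 𝐔, 𝐉, B) is defined and analytic on the space of all configurations 𝐔, 𝐉 satisfying the conditions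
  (i)–(iii) in Sect. 1, for some α′₀, α′₁ sufficiently small, but much bigger than α₀, α₁ there» — CLAIM, no declaration: §1
  `PkExtensionPrinted` (row B12.Eq3.1's decl of record `B12StepFromB13.TotalLeaves` is cited for «We will analyze this problem in one of
  the next sections in a general case», L4–L7: announcement).
* p. 270 L8–L12 programme («We want to represent them as a sum of localized, irrelevant terms … (0.28)») — announcement; its execution is
  `B12Sect3Closing281.sect3_remaining_irrelevant` (p. 281, block 22).
* p. 270 L13–L20 partition of unity — DEFINITION WITH BODY in tree (row B12.Def@270); «all the cubes in the scale corresponding to the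
  lattice T₁^{(k)}» — convention.
* p. 270 L27 «where we have used the results of Sect. G [15], and the equality (97) [12]» — provenance = the hypotheses `hE`, `hrep` of
  `B12FarTerms36.eq36`; «The function 𝐇_k and the operation Q_j are dependent on the configuration U_{k+1}» — remark.
* p. 271 L1–L13 the division and its two sub-cases, «small factor O((Lʲη)ᴺ) with an arbitrary power N» — PROVED: `B12Division35.farClass_cases`,
  `B12.exp_neg_inv_le_pow`, `B12NearTerms321.smallFactor321`, `B12Sect3Closing281.farTerm_irrelevant(_printed)`.
* p. 271 L17–L18 «differential with respect to t_□, at t_□ = 0, and this yields (3.7)» — PROVED `B12FarTerms36.hasDerivAt_farTerm`, `eq37`.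
* p. 271 L19–L20 «The derivative δ𝐇_k∕δB is an exponentially decaying function, with the decay rate δ₀ on the ξ-scale, see Proposition 9,
  (190) [15]» — by-reference input: `B11SectG.Ineq190` (hypothesis `h190` of `B12Ineq39.ineq39_of_ineq190`).
* p. 271 L23–p. 272 L1 «and the same for derivatives …» `B12Ineq39From190.ineq39_sectG_strong`; «Using the above bound, and the
  analyticity properties of 𝐄^{(j)}, we can obtain easily the required bound for (3.7)» = (3.15)–(3.17): `B12CauchyRemainder354.ineq317_printed`.
* p. 272 L1–L5 — row B12.Txt@272 (PROVED).
* p. 272 L6–L13 (3.10)–(3.11) and «𝐅 is a local operator …» — row B12.Eq3.10-3.12 (PROVED ∕ `B12Eq311Locality`).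
* p. 272 L13–L22 «It is the term D*D𝐀 … source of a trouble. For 𝐀 = 𝐇_j we have bounds … only if we use the second representation … (180)
  [15]. … Landau gauge condition RD*𝐇_j = 0, and we replace D*D by … = Δ − P₁ + (lower order, local operator)» — the identity is PROVED
  (`B12Eq311Landau.landau_replacement`); the surrounding sentences («we will construct an expansion of 𝐇_j … good bounds … Such bounds do not
  hold for the operator D*D, and this is the reason why we do not formulate second order regularity conditions») — motivation ∕ announcement
  (Sect. 4, block 23), not statements.
* p. 272 L25–L33 «We consider it on the space U^c_j(X, ½α₀, ½α₁, α₀) … analytic … also an analytic function of 𝐀 … Thus, there exists a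
  constant α₂ …(3.14)» — row B12.Eq3.13-3.14 (α₂ explicit in tree); L34–L35 «Of course, on these spaces of configurations 𝐔, 𝐉, 𝐀 the
  function (3.13) satisfies the inequality (1.18)» — CLAIM, no declaration: §1 `Bound118On314Printed`.
* p. 273 L1–L4 «we substitute 𝐀 = 𝐇_j(B(t)) + t_□⟨…⟩ … These functions are given by (179), (180) [15], and we replace … by 𝐔, 𝐉» —
  definition by reference (`B11SectG`); L4–L7 (3.15) + radius — row B12.Eq3.15 (the radius equality is the hypothesis `hrad` of
  `B12CauchyRemainder354.ineq317_chain`; its consequence PROVED here §3).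
* p. 273 L8–L9 «We assume also that ε₁ is so small that 𝐇_j(B(t)) satisfies (3.14) with ⅓α₂ on the right-hand side» — STANDING
  RESTRICTION on ε₁, no declaration: §1 `Eps1For314Printed` (RULING #9 (2) binder).
* p. 273 L9–L12 «Thus we have constructed the analytic extension (3.15) of the function (3.7), defined on the space (3.16)» — row
  B12.Eq3.15-3.16; L13–L15 (3.17) «following from (3.9)» — row B12.Eq3.17 (PROVED).
* p. 273 L15–L18 «Let us stress that it follows only from the fact that 𝐇_j(B(t)) satisfies (3.14) with ⅓α₂, and δ𝐇_j satisfies (3.9)»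
  — dependency statement, PROVED here as bookkeeping (§3 `bound317`: exactly these two inputs + the chart analyticity + (1.18));
  «Later we will change these functions by a localization procedure, but new localized functions will satisfy the bounds (3.14), (3.9),
  hence (3.17) will be preserved also» — announcement (Sect. 4; the preservation is `bound317` re-instantiated).
* p. 273 L19–L22 «the above considerations apply almost without a change to the second case, with a big domain X. The only difference is
  that we do not have the exponential factors in (3.9), (3.17)» — CLAIM: the second-case (3.9) typed §1 `Ineq39SecondCasePrinted` (field
  `ineq39big`); the second-case (3.17) is `B12CauchyRemainder354.ineq317_chain` with the exponential-free `s` (parametric), and the passage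
  first case ⇒ second-case shape is PROVED (§3 `secondCase_of_ineq39`).
* p. 273 L23–L27 «the fundamental case … without obvious small factors. The real renormalization problem is connected exactly with this
  case» — commentary.
* p. 273 L27–L33 «We take the function U_j constructed for the cube □₀ = □̃⁵ as in the condition (iv) … Thus we construct a sequence of
  cubes {□_n} … (1.3)–(1.6) [14] … hence □̃⁴ ⊂ □_{k+1}. For this sequence we construct the functions U_j … U_j(□₀)» — DEFINITION by
  reference ([14]: `B12RegularSpaces111.CondIV`, `B12Eq115BackgroundPair`) + the inclusion PROVED as arithmetic `B12Interfaces.collar_fits`.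
* p. 274 L1 «Using the gauge invariance, and similar transformations as in (3.3), we obtain (3.19)» — PROVED `B12NearTerms321.eq319`.
* p. 274 L4–L7 «Later it will be important to have the configuration B_□ only … so we remove from (3.19) a part … localized outside □̃³.
  Take a function ζ̃_□ …» — motivation + row B12.Def@274.
* p. 274 L12–L17 the sentence after (3.21) — PROVED (`le_dist_of_tilde2_of_closure_compl_tilde3`, `smallFactor321`; the «bound of the
  type (3.9)» for ⟨…⟩ is the field `ineq39` instantiated at that datum).
* p. 274 L18–L25 (3.22) and «We remove the expression in the square brackets … localized in □̃⁴∖□̃³ … same properties, so we apply the same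
  considerations as before» — PROVED `B12NearTerms321.eq322`, `support_bracket322_subset`; «same considerations» = `eq321` ∕ `bound317`
  re-instantiated.
* p. 275 L1–L8 (after (3.23)) «This equality is connected with the way we introduce the variables 𝐔, 𝐉 … Now we introduce the variables
  𝐔, 𝐉 in these expressions in a slightly different way … replaced by the configuration U_{k+1}(□₀, M˙(𝐔)), extended as equal to 𝐔
  outside □₀. We do it in order to get better properties with respect to gauge transformations» — DEFINITION (row B12.Eq3.24-3.25,
  `B12Inv329.Recipe`) + motivation.
* p. 275 L9–L11 «Let us remark that U_{k+1}(□₀, M˙(𝐔)) has approximately the same regularity properties as 𝐔, hence all necessary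
  theorems are valid for operations with this configuration» — REMARK without a definite statement (no constants printed); its
  quantitative content is (3.26)–(3.27) p. 275 (block 22, `B12Spaces329NearBond`, `B12Spaces329NearStep`); not typed.
* p. 275 L13–L16 «In fact we should replace the function 𝐄^{(j)}(X, U_j) by 𝐄^{(j)}(X, U_j, J_j) … we will keep the above notation» —
  notational remark.
* p. 275 L18–L21 «This is obviously a well defined and analytic function of the variables 𝐔, 𝐉 in a sufficiently small domain. We will
  prove that it is analytic on the space U_{k+1}(□₀, (1+2β)α₀, (1+2β)α₁, α₀). This space is defined by …» — announcement of Lemma 4's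
  use (block 22) + DEFINITION: row B12.Eq3.24-3.25 (`B12Lemma4Uses.analyticAt_E325_of_eq328`).
Hence the residual of block 21 = the five §1 shapes; everything else printed on pp. 269–275 up to (3.25) is cited above.  ((3.26)–(3.27),
printed on p. 275 ll. 27–38, belong to block 22 by display number — CARVE-LIST v5 boundary note.)

CARRIERS (those of the cited kernel files; nothing re-declared).  Fluctuation fields `B` on T₁^{(k)}: a real normed space `𝓑` (sup norm).
Pairs (𝐔, 𝐉): a complex normed space `Φ` (the chart reading of record, `B12.Eq118Analyticity263`: Gᶜ × 𝔤ᶜ-valued bond functions, the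
spaces open, «analytic on the space» = `AnalyticOnNhd ℂ`), with «the configurations satisfying (i)–(iii) in Sect. 1 with constants
a₀, a₁» an abstract two-parameter family `spI_III a₀ a₁ : Set Φ` (concretely `{Φ | B12RegularSpaces111.SatisfiesI_III F c a₀ a₁ a₀}`).
Fields `𝐀` on the bonds of a localization domain `X` (the variable of (3.13)–(3.14)): a complex normed space `EA g` per far-term datum
`g` (= (j, X, the pair (𝐔, 𝐉) ∈ U^c_j(X, ½α₀, ½α₁, α₀))), WHOSE NORM IS THE (3.14)-SIZE `max{|𝐀|_X, |P₁𝐀|_X, |∇^ξ_𝐔𝐀|_X, |Δ^ξ_𝐔𝐀|_X}`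
(so «𝐀 satisfies (3.14)» = `‖𝐀‖ < α₂`, «with ⅓α₂ on the right-hand side» = `‖𝐀‖ < α₂∕3`, and the radius equality of (3.15) is
`r * ‖δ𝐇_j‖ = α₂∕3`); the function (3.13) at the datum `g`: `G g : EA g → F`, `F` a complex normed space of values.  (3.9): the named
reals `B12Ineq39.Data39` per instance `i` (term, cube □, block of X, B′, t).  (3.18), (3.20): the configuration ∕ average ∕ bond-function
carriers of `B12NearTerms321` §§1–2, per near-term datum `σ` (= (j, □)).

DISCIPLINE.  0 `sorry`; no `axiom`; no new `instance`, `notation`, `macro`; imports: two Literature modules; nothing in the tree is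
modified; every decl carries a `[cite: …]`; no closed `def X : Prop` fact — §1 are predicates with explicit arguments used as the
fields of `Hyp` (hypotheses a consumer instantiates), §3 are theorems.
-/

namespace Literature.MathematicalPhysics.QuantumFieldTheory.Balaban1983to89.B12Carve21Sect3ExpansionHyp

open Literature.MathematicalPhysics.QuantumFieldTheory.Balaban1983to89
open Set Metric

/-! ## §1  The printed statements of the block without an in-tree declaration (hypothesis form, objects explicit) -/

section Pk

variable {𝓑 : Type*}

/-- **p. 269 ll. 33–36 [PDF 21]** (`p0021.txt:L32–L36`), verbatim: «This function [𝐏^{(k)}(g_k, U_{k+1}, B)], although it has a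
complicated structure, is simple to understand. It is an analytic function of the fluctuation field B defined on the unit lattice
T₁^{(k)}. It is bounded by a second order polynomial in B, with coefficients of the order O(ε₁), hence it can be treated as a small
perturbation of the basic quadratic form in the Gaussian measure dμ_{C^{(k)}}.»  TYPED for ONE step `k`, one coupling `g_k` and one
background `U_{k+1}` (all fixed inside `P : 𝓑 → ℝ`, the object `B12Eq213Body268.FluctData.P` of (2.13) read as a function of `B`
alone), on the set `SB` of fluctuation fields considered (the support of χ_k, (2.9) p. 266 — print names no domain), with the absolute
constant `C` of «O(ε₁)» displayed: `P` is real-analytic about every point of `SB`, and `|P(B)| ≤ c₀ + c₁|B| + c₂|B|²` on `SB` with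
`0 ≤ c_i ≤ Cε₁`.  No declaration stated this sentence (row B12.Eq3.1's decl of record is the [II]-side bundle
`B12StepFromB13.TotalLeaves`). [cite: Balaban1987RG1, §3 p.269 ll.33–36] -/
def PkFluctuationPrinted [NormedAddCommGroup 𝓑] [NormedSpace ℝ 𝓑] (P : 𝓑 → ℝ) (SB : Set 𝓑) (C ε₁ : ℝ) : Prop :=
  AnalyticOnNhd ℝ P SB ∧
    ∃ c₀ c₁ c₂ : ℝ, (0 ≤ c₀ ∧ c₀ ≤ C * ε₁) ∧ (0 ≤ c₁ ∧ c₁ ≤ C * ε₁) ∧ (0 ≤ c₂ ∧ c₂ ≤ C * ε₁) ∧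
      ∀ B ∈ SB, |P B| ≤ c₀ + c₁ * ‖B‖ + c₂ * ‖B‖ ^ 2

/-- Unfolding: «bounded by a second order polynomial in B, with coefficients of the order O(ε₁)» gives the one-constant form
`|𝐏^{(k)}(B)| ≤ Cε₁(1 + |B| + |B|²)` on `SB`. [cite: Balaban1987RG1, §3 p.269 ll.35–36] -/
theorem PkFluctuationPrinted.abs_le [NormedAddCommGroup 𝓑] [NormedSpace ℝ 𝓑] {P : 𝓑 → ℝ} {SB : Set 𝓑} {C ε₁ : ℝ}
    (h : PkFluctuationPrinted P SB C ε₁) {B : 𝓑}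
    (hB : B ∈ SB) : |P B| ≤ C * ε₁ * (1 + ‖B‖ + ‖B‖ ^ 2) := by
  obtain ⟨-, c₀, c₁, c₂, ⟨-, h₀⟩, ⟨-, h₁⟩, ⟨-, h₂⟩, hP⟩ := h
  have hn : 0 ≤ ‖B‖ := norm_nonneg B
  have hn2 : 0 ≤ ‖B‖ ^ 2 := by positivity
  calc |P B| ≤ c₀ + c₁ * ‖B‖ + c₂ * ‖B‖ ^ 2 := hP B hB
    _ ≤ C * ε₁ + C * ε₁ * ‖B‖ + C * ε₁ * ‖B‖ ^ 2 :=
        add_le_add (add_le_add h₀ (mul_le_mul_of_nonneg_right h₁ hn)) (mul_le_mul_of_nonneg_right h₂ hn2)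
    _ = C * ε₁ * (1 + ‖B‖ + ‖B‖ ^ 2) := by ring

variable {Φ : Type*} [NormedAddCommGroup Φ] [NormedSpace ℂ Φ]

/-- **(3.1) with p. 269 l. 37–p. 270 l. 3 [PDF 21–22]** (`p0021.txt:L37`–`p0022.txt:L4`), verbatim: «As a function of the gauge field
configuration U_{k+1} it has a straightforwardly defined extension 𝐏^{(k)}(g_k, 𝐔, 𝐉, B) such, that
  𝐏^{(k)}(g_k, U_{k+1}, B) = 𝐏^{(k)}(g_k, U_{k+1}, J_{k+1}, B).   (3.1)
This extension is obtained by replacing the function J_{k+1} in all propagators and operators by the variable 𝐉, and by replacing the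
configuration U_{k+1} in all other places by the variable 𝐔. The function 𝐏^{(k)}(g_k, 𝐔, 𝐉, B) is defined and analytic on the space of
all configurations 𝐔, 𝐉 satisfying the conditions (i)–(iii) in Sect. 1, for some α′₀, α′₁ sufficiently small, but much bigger than
α₀, α₁ there.»  TYPED for one step (coupling and step fixed inside the functions): `Pext : Φ → 𝓑 → ℂ` the extension on the complex
configuration carrier `Φ` of pairs (𝐔, 𝐉) (chart reading of record, `B12.Eq118Analyticity263`), `spI_III a₀ a₁ ⊆ Φ` «the configurations
satisfying (i)–(iii) in Sect. 1 with constants a₀, a₁» (concretely `B12RegularSpaces111.SatisfiesI_III … a₀ a₁ a₀`), `bk ∈ Φ` the real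
pair `(U_{k+1}, J_{k+1})`, `P` the function of B of p. 269 on its set `SB` of fluctuation fields: THERE ARE constants `α′₀ > α₀`,
`α′₁ > α₁` («much bigger» read as «bigger»; «sufficiently small» is absorbed by the existential) such that for every `B ∈ SB` the map
`(𝐔, 𝐉) ↦ 𝐏^{(k)}(g_k, 𝐔, 𝐉, B)` is analytic about every point of `spI_III α′₀ α′₁`, and (3.1) holds on `SB`.  No declaration stated this (row B12.Eq3.1's decl of record
`B12StepFromB13.TotalLeaves` is the [II]-side bundle delivering the announced localisation «in one of the next sections in a general
case»). [cite: Balaban1987RG1, (3.1) p.269 with p.270 ll.1–3] -/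
def PkExtensionPrinted (spI_III : ℝ → ℝ → Set Φ) (α₀ α₁ : ℝ) (Pext : Φ → 𝓑 → ℂ) (bk : Φ) (P : 𝓑 → ℝ) (SB : Set 𝓑) :
    Prop :=
  ∃ α₀' α₁' : ℝ, α₀ < α₀' ∧ α₁ < α₁' ∧
    (∀ B ∈ SB, AnalyticOnNhd ℂ (fun φ => Pext φ B) (spI_III α₀' α₁')) ∧ ∀ B ∈ SB, Pext bk B = (P B : ℂ)

/-- Bookkeeping: with the spaces monotone in their constants (p. 263 «We assume that the constants α₀′, α₁′ are smaller than α₀, α₁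
correspondingly, then obviously these three conditions are satisfied in the original formulation», PROVED on the concrete carriers as
`B12RegularSpaces111Mono.satisfiesI_III_mono`), the extension is in particular analytic on the (i)–(iii)-space with the ORIGINAL constants
`α₀, α₁` — the form in which the inductive spaces of Sect. 1 consume it. [cite: Balaban1987RG1, p.270 ll.1–3 with §1 p.263] -/
theorem PkExtensionPrinted.analyticOnNhd_of_mono {spI_III : ℝ → ℝ → Set Φ} {α₀ α₁ : ℝ} {Pext : Φ → 𝓑 → ℂ} {bk : Φ}
    {P : 𝓑 → ℝ} {SB : Set 𝓑} (h : PkExtensionPrinted spI_III α₀ α₁ Pext bk P SB)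
    (hmono : ∀ ⦃a₀ a₁ a₀' a₁' : ℝ⦄, a₀ ≤ a₀' → a₁ ≤ a₁' → spI_III a₀ a₁ ⊆ spI_III a₀' a₁') {B : 𝓑} (hB : B ∈ SB) :
    AnalyticOnNhd ℂ (fun φ => Pext φ B) (spI_III α₀ α₁) := by
  obtain ⟨a₀', a₁', h₀, h₁, han, -⟩ := h
  exact (han B hB).mono (hmono h₀.le h₁.le)

/-- Unfolding of (3.1): the extension restricts to `𝐏^{(k)}(g_k, U_{k+1}, B)` at the real pair. [cite: Balaban1987RG1, (3.1) p.269] -/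
theorem PkExtensionPrinted.restricts {spI_III : ℝ → ℝ → Set Φ} {α₀ α₁ : ℝ} {Pext : Φ → 𝓑 → ℂ} {bk : Φ} {P : 𝓑 → ℝ}
    {SB : Set 𝓑} (h : PkExtensionPrinted spI_III α₀ α₁ Pext bk P SB) {B : 𝓑} (hB : B ∈ SB) : Pext bk B = (P B : ℂ) := by
  obtain ⟨_, _, -, -, -, hr⟩ := h
  exact hr B hB

end Pk

section Far

variable {EA F : Type*} [NormedAddCommGroup EA] [NormedSpace ℂ EA] [NormedAddCommGroup F] [NormedSpace ℂ F]

/-- **p. 272 ll. 34–35 [PDF 24]** (`p0024.txt:L41–L42`), verbatim: «Of course, on these spaces of configurations 𝐔, 𝐉, 𝐀 the function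
(3.13) satisfies the inequality (1.18).»  ((1.18) p. 263: «|𝐄^{(j)}(X, g_{j−1}, 𝐔, 𝐉)| ≤ E₀ exp(−κd_j(X))»; the spaces: (𝐔, 𝐉) ∈
U^c_j(X, ½α₀, ½α₁, α₀) and 𝐀 with «|𝐀|, |P₁𝐀|, |∇^ξ_𝐔𝐀|, |Δ^ξ_𝐔𝐀| < α₂ on X. (3.14)».)  TYPED at ONE datum (j, X, (𝐔, 𝐉)) fixed
inside `G : EA → F` = 𝐀 ↦ 𝐄^{(j)}(X, exp iξ𝐀𝐔, (Lʲ⁻¹η)³𝐉 + Δ^ξ_𝐔𝐀 − P₁𝐀 + 𝐅₁(𝐔, 𝐀)) (the function (3.13)), the norm of `EA` being the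
(3.14)-size `max{|𝐀|_X, |P₁𝐀|_X, |∇^ξ_𝐔𝐀|_X, |Δ^ξ_𝐔𝐀|_X}`: on the (3.14)-set the value is bounded by `E₀ e^{−κ d_j(X)}` (`dX` = d_j(X)).
This is the bare input `hM` («‖Φ t‖ ≤ M₀ on the circle … M₀ = E₀exp(−κd_j(X)) by (1.18)») of `B12CauchyRemainder354.ineq317`; no
declaration stated it. [cite: Balaban1987RG1, §3 p.272 ll.34–35 with (1.18) p.263 and (3.14) p.272] -/
def Bound118On314Printed (α₂ : ℝ) (G : EA → F) (E₀ κ dX : ℝ) : Prop :=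
  ∀ A : EA, ‖A‖ < α₂ → ‖G A‖ ≤ E₀ * Real.exp (-(κ * dX))

/-- **p. 273 ll. 19–22 [PDF 25]** (`p0025.txt:L23–L26`), verbatim: «We remark that the above considerations apply almost without a
change to the second case, with a big domain X. The only difference is that we do not have the exponential factors in (3.9), (3.17)
connected with the decay rate of the functional derivative (δ∕δB)𝐇_j.»  TYPED, for the (3.9)-half, over the named reals of the display
(3.9) (`B12Ineq39.Data39`, the carrier of row B12.Eq3.9): the second-case bound `|δ𝐇_j| ≤ B₃ × 2Lʲη|ζ_□𝐇_k(B′)|` on X — (3.9) with its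
factor `exp(−½δ₀dist^{(ξ)}(X, □) − ½δ₀M(Lʲη)⁻¹)` deleted.  (The (3.17)-half needs no declaration: `B12CauchyRemainder354.ineq317_chain`
is parametric in the (3.9)-factor `s`.)  No declaration stated the second-case (3.9) (`B12Ineq39`'s scope note: «NOT HERE: … the second
case of (3.5)»). [cite: Balaban1987RG1, §3 p.273 ll.19–22 with (3.9) p.271] -/
def Ineq39SecondCasePrinted (D : B12Ineq39.Data39) : Prop :=
  D.lhs ≤ D.B₃ * (2 * D.Ljη * D.normZH)

variable {ιG T : Type*} (EA' : ιG → Type*) [∀ g, NormedAddCommGroup (EA' g)]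

/-- **p. 273 ll. 8–9 [PDF 25]** (`p0025.txt:L11–L12`), verbatim: «We assume also that ε₁ is so small that 𝐇_j(B(t)) satisfies (3.14)
with ⅓α₂ on the right-hand side.»  A STANDING RESTRICTION on the small-field cut-off `ε₁` of (2.9) (through `|B′| < ε₁` on the support of
χ_k, hence the smallness of 𝐇_k(B′), B(t) = tζ_□𝐇_k(B′) + … of (3.4), and 𝐇_j(B(t))), displayed per RULING #9 (2) of the cell lead
(`carve/STATUS.md` 2026-08-28T07:49:36Z) as a threshold binder: `adm ε₁ ⊆ T` is the set of far-term data τ = (g, B′, t) admissible under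
the cut-off `ε₁`, `termOf τ = g` its datum (j, X, (𝐔, 𝐉)), `HjB τ ∈ EA' g` the configuration 𝐇_j(B(t)) measured in the (3.14)-size of
`X`; THERE IS `a > 0` such that for every `0 < ε₁ ≤ a` every admissible 𝐇_j(B(t)) has (3.14)-size `< ⅓α₂`.  No declaration stated this
(it is the silent part of the hypothesis `hmaps` of `B12.Eq118Analyticity263.SFHypAnalytic.differentiableOn_E_line`, HONEST SCOPE (2)
there). [cite: Balaban1987RG1, §3 p.273 ll.8–9 with (3.14) p.272 and (2.9) p.266] -/
def Eps1For314Printed (α₂ : ℝ) (adm : ℝ → Set T) (termOf : T → ιG) (HjB : ∀ τ : T, EA' (termOf τ)) : Prop :=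
  ∃ a > 0, ∀ ε₁ : ℝ, 0 < ε₁ → ε₁ ≤ a → ∀ τ ∈ adm ε₁, ‖HjB τ‖ < α₂ / 3

end Far

/-! ## §2  The bundle -/

/-- **Block 21 of the carving fan — [Balaban1987RG1] Sect. 3 part 1, pp. 269–275, (3.1)–(3.25) — as ONE hypothesis-form bundle**, at
one renormalization step `k` of one run (coupling `g_k`, constants `ε₁, α₀, α₁, α₂, E₀, κ` of Theorem 3 ∕ (1.18) ∕ (3.14)), over the
carriers listed in the module docstring.  Fields, in print order: `pkFluct` = p. 269 ll. 33–36 (`PkFluctuationPrinted`, §1); `pkExt` =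
(3.1) + p. 270 ll. 1–3 (`PkExtensionPrinted`, §1); `ineq39` = (3.9) p. 271 in its printed first case `dist^{(ξ)}(X, □) ≥ M(Lʲη)⁻¹`
(`B12Ineq39.Ineq39Printed`, BY NAME, one instance `D39 i` per datum `i` = (term, □, block of X, B′, t); the case is the inequality
`Minv ≤ distX` of its own named reals, as in `B12Ineq39.ineq39_of_ineq190`'s `hcase`); `bound118` = p. 272 ll. 34–35
(`Bound118On314Printed`, §1) at every far-term datum `g`; `eps1` = p. 273 ll. 8–9 (`Eps1For314Printed`, §1; the run's own cut-off is the
parameter `ε₁` of `pkFluct`, and the dischargeable instance of `eps1` is `ε = ε₁ ≤ a`); `ineq39big` = the second-case form of (3.9),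
p. 273 ll. 19–22 (`Ineq39SecondCasePrinted`, §1), on the data flagged `big i` («X ∩ □̃ ≠ ∅ … X is a big domain in ξ-scale», p. 271); `eq318` =
(3.18) p. 273 (`B12NearTerms321.Eq318`, BY NAME) and `eq320` = (3.20) p. 274 (`B12NearTerms321.Eq320`, BY NAME) at every near-term datum
`σ` = (j, □) and every field `b ∈ Bsq σ` (the configurations B_□ occurring in (3.19)).  The PROVED rows of the block (module docstring
table) are theorems of the tree and therefore not hypotheses; the DEFINITIONS (3.2), (3.8), (3.10), (3.13), (3.16), (3.22), (3.24)–(3.25)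
and the profiles ζ, ζ̃_□ are the cited carriers.  A consumer takes `(h : Hyp …)` and uses §3.
[cite: Balaban1987RG1, §3 (3.1)–(3.25) pp.269–275] -/
structure Hyp
    -- p. 269–270: 𝐏^{(k)} and its extension
    {𝓑 : Type*} [NormedAddCommGroup 𝓑] [NormedSpace ℝ 𝓑] (P : 𝓑 → ℝ) (SB : Set 𝓑) (C ε₁ : ℝ)
    {Φ : Type*} [NormedAddCommGroup Φ] [NormedSpace ℂ Φ] (spI_III : ℝ → ℝ → Set Φ) (α₀ α₁ : ℝ) (Pext : Φ → 𝓑 → ℂ) (bk : Φ)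
    -- (3.9): one `Data39` per instance, the big-domain flag
    {ι₃₉ : Type*} (D39 : ι₃₉ → B12Ineq39.Data39) (big : ι₃₉ → Prop)
    -- (3.13)–(3.17): far-term data `g`, the (3.14)-normed fields `EA g`, the function (3.13), (1.18)'s constants, d_j(X)
    {ιG : Type*} (EA : ιG → Type*) [∀ g, NormedAddCommGroup (EA g)] [∀ g, NormedSpace ℂ (EA g)]
    {F : Type*} [NormedAddCommGroup F] [NormedSpace ℂ F] (α₂ : ℝ) (G : ∀ g, EA g → F) (E₀ κ : ℝ) (dX : ιG → ℝ)
    -- p. 273: the admissible (g, B′, t) under the cut-off, and 𝐇_j(B(t))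
    {T : Type*} (adm : ℝ → Set T) (termOf : T → ιG) (HjB : ∀ τ : T, EA (termOf τ))
    -- (3.18), (3.20): near-term data `σ`
    {Sq EB 𝒰 𝒱 : Type*} (rep : Sq → EB → 𝒰) (rep0 : Sq → 𝒱 → 𝒰) (Mav : Sq → 𝒰 → 𝒱) (Dfl : Sq → Set EB)
    {ι V EH : Type*} (Qavg : Sq → EH → ι → V) (Hj : Sq → (ι → V) → EH) (N4 : Sq → Set ι) (Bsq : Sq → Set (ι → V)) :
    Prop where
  /-- **p. 269 ll. 33–36** «analytic function of the fluctuation field B … bounded by a second order polynomial in B, with coefficients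
  of the order O(ε₁)» — `PkFluctuationPrinted` (§1). [cite: Balaban1987RG1, §3 p.269 ll.33–36] -/
  pkFluct : PkFluctuationPrinted P SB C ε₁
  /-- **(3.1) + p. 270 ll. 1–3** «defined and analytic on the space of all configurations 𝐔, 𝐉 satisfying the conditions (i)–(iii) …
  α′₀, α′₁ … much bigger than α₀, α₁» — `PkExtensionPrinted` (§1). [cite: Balaban1987RG1, (3.1) p.269, p.270 ll.1–3] -/
  pkExt : PkExtensionPrinted spI_III α₀ α₁ Pext bk P SB
  /-- **(3.9) p. 271**, first case «In the case when dist^{(ξ)}(X, □) ≥ M(Lʲη)⁻¹» — `B12Ineq39.Ineq39Printed`, BY NAME.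
  [cite: Balaban1987RG1, (3.9) p.271] -/
  ineq39 : ∀ i, (D39 i).Minv ≤ (D39 i).distX → B12Ineq39.Ineq39Printed (D39 i)
  /-- **p. 272 ll. 34–35** «on these spaces … the function (3.13) satisfies the inequality (1.18)» — `Bound118On314Printed` (§1), at every
  far-term datum. [cite: Balaban1987RG1, §3 p.272 ll.34–35] -/
  bound118 : ∀ g, Bound118On314Printed α₂ (G g) E₀ κ (dX g)
  /-- **p. 273 ll. 8–9** «We assume also that ε₁ is so small that 𝐇_j(B(t)) satisfies (3.14) with ⅓α₂» — `Eps1For314Printed` (§1).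
  [cite: Balaban1987RG1, §3 p.273 ll.8–9] -/
  eps1 : Eps1For314Printed EA α₂ adm termOf HjB
  /-- **p. 273 ll. 19–22**, (3.9) in the second case, «we do not have the exponential factors» — `Ineq39SecondCasePrinted` (§1).
  [cite: Balaban1987RG1, §3 p.273 ll.19–22] -/
  ineq39big : ∀ i, big i → Ineq39SecondCasePrinted (D39 i)
  /-- **(3.18) p. 273** — `B12NearTerms321.Eq318`, BY NAME, at every near-term datum. [cite: Balaban1987RG1, (3.18) p.273] -/
  eq318 : ∀ σ, B12NearTerms321.Eq318 (rep σ) (rep0 σ) (Mav σ) (Dfl σ)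
  /-- **(3.20) p. 274** «Q(ξ𝐇_j(B_□)) = Q_j(ξU_j(B_□)) = B_□ on a neighborhood of □̃⁴» — `B12NearTerms321.Eq320`, BY NAME, at every
  near-term datum and every occurring `B_□`. [cite: Balaban1987RG1, (3.20) p.274] -/
  eq320 : ∀ σ, ∀ b ∈ Bsq σ, B12NearTerms321.Eq320 (Qavg σ) (Hj σ) (N4 σ) b

/-! ## §3  Kernel-checked bookkeeping (no statement asserted) -/

section Radius

variable {EA F : Type*} [NormedAddCommGroup EA] [NormedSpace ℂ EA] [NormedAddCommGroup F] [NormedSpace ℂ F]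

/-- **The radius condition of (3.15) does its job** (p. 273: «with the radius r given by the equality r max{|δ𝐇_j|_X, |P₁δ𝐇_j|_X,
|∇^ξ_𝐔δ𝐇_j|_X, |Δ^ξ_𝐔δ𝐇_j|_X} = ⅓α₂. We assume also that ε₁ is so small that 𝐇_j(B(t)) satisfies (3.14) with ⅓α₂ … Let us stress
that it follows only from the fact that 𝐇_j(B(t)) satisfies (3.14) with ⅓α₂»): in the (3.14)-size, `‖𝐇‖ < ⅓α₂` and `r‖δ𝐇‖ = ⅓α₂` give
`‖𝐇 + t_□δ𝐇‖ < α₂` for every complex `|t_□| ≤ 2r` — the bracket of (3.15) obeys (3.14) on a disc TWICE the integration radius.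
Triangle inequality. [cite: Balaban1987RG1, (3.15) p.273 with (3.14) p.272] -/
theorem norm_line_lt_of_third {α₂ r : ℝ} {H δH : EA} (hH : ‖H‖ < α₂ / 3) (hrad : r * ‖δH‖ = α₂ / 3) {t : ℂ}
    (ht : ‖t‖ ≤ 2 * r) : ‖H + t • δH‖ < α₂ := by
  have h2 : 2 * r * ‖δH‖ = 2 * (α₂ / 3) := by rw [mul_assoc, hrad]
  calc ‖H + t • δH‖ ≤ ‖H‖ + ‖t‖ * ‖δH‖ := (norm_add_le _ _).trans (by rw [norm_smul])
    _ ≤ ‖H‖ + 2 * r * ‖δH‖ := by gcongr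
    _ < α₂ / 3 + 2 * (α₂ / 3) := by rw [h2]; linarith
    _ = α₂ := by ring

/-- The same as a `MapsTo` statement: the affine line `t_□ ↦ 𝐇_j(B(t)) + t_□δ𝐇_j` carries the closed disc of radius `2r` into the
(3.14)-set `{𝐀 | ‖𝐀‖ < α₂}` — the geometric input `hmaps` of `B12.Eq118Analyticity263.SFHypAnalytic.differentiableOn_E_affineLine`
(HONEST SCOPE (2) there: «not proved here»), now proved from the two printed conditions. [cite: Balaban1987RG1, (3.15) p.273] -/
theorem mapsTo_line_closedBall {α₂ r : ℝ} {H δH : EA} (hH : ‖H‖ < α₂ / 3) (hrad : r * ‖δH‖ = α₂ / 3) :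
    MapsTo (fun t : ℂ => H + t • δH) (closedBall (0 : ℂ) (2 * r)) {A : EA | ‖A‖ < α₂} := fun _ ht =>
  norm_line_lt_of_third hH hrad (mem_closedBall_zero_iff.mp ht)

/-- Hence, with the function (3.13) complex-differentiable on the (3.14)-set (row B12.Eq3.13-3.14: «analytic in 𝐀, for 𝐀 satisfying the
conditions (3.14)», `B12.Eq118Analyticity263.SFHypAnalytic.analyticOnNhd_E_chart` with `B12Membership313II` ∕ `B12Eq313JSlot`; the
hypothesis `hG`), the one-variable function of (3.15) `t_□ ↦ 𝐄^{(j)}(X, exp iξ[𝐇_j(B(t)) + t_□δ𝐇_j]𝐔, …)` is holomorphic on the open disc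
of radius `2r` — the input `hΦ : DifferentiableOn ℂ Φ (ball 0 R)`, `R = 2r > r`, of `B12CauchyRemainder354.deriv_eq_circleIntegral_315` ∕
`ineq317`. [cite: Balaban1987RG1, (3.15) p.273] -/
theorem differentiableOn_line {α₂ r : ℝ} {H δH : EA} {G : EA → F} (hG : DifferentiableOn ℂ G {A : EA | ‖A‖ < α₂})
    (hH : ‖H‖ < α₂ / 3) (hrad : r * ‖δH‖ = α₂ / 3) :
    DifferentiableOn ℂ (fun t : ℂ => G (H + t • δH)) (ball (0 : ℂ) (2 * r)) := by
  have hline : Differentiable ℂ (fun t : ℂ => H + t • δH) := fun t =>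
    (differentiableAt_const H).add ((differentiableAt_id).smul_const δH)
  refine hG.comp hline.differentiableOn ?_
  intro t ht
  exact norm_line_lt_of_third hH hrad (le_of_lt (mem_ball_zero_iff.mp ht))

/-- **(3.17) assembled from the printed inputs** (p. 273: «This function has the bound |(3.15)| ≤ (1∕r)E₀exp(−κd_j(X)) ≤
E₀exp(−κd_j(X))6α₂⁻¹LʲηB₀B₃ exp(−½δ₀dist^{(ξ)}(X, □) − ½δ₀M(Lʲη)⁻¹)|ζ_□𝐇_k(B′)|, (3.17) following from (3.9). Let us stress that it
follows only from the fact that 𝐇_j(B(t)) satisfies (3.14) with ⅓α₂, and δ𝐇_j satisfies (3.9).»): from (i) the analyticity of (3.13) on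
the (3.14)-set (`hG`), (ii) (1.18) there (`h118`, §1 `Bound118On314Printed`), (iii) «𝐇_j(B(t)) satisfies (3.14) with ⅓α₂» (`hH`), (iv) the
radius equality (`hrad`, `m = ‖δ𝐇_j‖ > 0`) and (v) the (3.9)-type bound `‖δ𝐇_j‖ ≤ 2s` (`h39`; first case `s` = LʲηB₀B₃exp(…)|ζ_□𝐇_k(B′)|,
second case the same without the exponential), the t_□-derivative at 0 of (3.15) has norm `≤ E₀e^{−κd_j(X)}·6α₂⁻¹·s` — by
`B12CauchyRemainder354.ineq317_printed` at `R = 2r`. [cite: Balaban1987RG1, (3.17) p.273] -/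
theorem bound317 {α₂ r s E₀ κ dX : ℝ} {H δH : EA} {G : EA → F} (hG : DifferentiableOn ℂ G {A : EA | ‖A‖ < α₂})
    (h118 : Bound118On314Printed α₂ G E₀ κ dX) (hE₀ : 0 ≤ E₀) (hH : ‖H‖ < α₂ / 3) (hr : 0 < r) (hm : 0 < ‖δH‖)
    (hrad : r * ‖δH‖ = α₂ / 3) (h39 : ‖δH‖ ≤ 2 * s) :
    ‖deriv (fun t : ℂ => G (H + t • δH)) 0‖ ≤ E₀ * Real.exp (-(κ * dX)) * (6 * α₂⁻¹ * s) := by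
  have hα₂ : 0 < α₂ := by
    have := mul_pos hr hm
    linarith
  have hrR : r < 2 * r := by linarith
  refine B12CauchyRemainder354.ineq317_printed hr hrR (differentiableOn_line hG hH hrad) ?_ (by positivity) hm hα₂ hrad h39
  intro t ht
  exact h118 _ (norm_line_lt_of_third hH hrad (by rw [mem_sphere_zero_iff_norm.mp ht]; linarith))

end Radius

/-- **First case ⇒ second-case shape** (p. 273 «The only difference is that we do not have the exponential factors in (3.9)»): with
nonnegative rate, lengths, constant and factor, the first-case display (3.9) implies the exponential-free bound (the factor is `≤ 1`) —
so `Ineq39SecondCasePrinted` is the WEAKER of the two printed forms, as print says. [cite: Balaban1987RG1, (3.9) p.271, p.273 ll.19–22] -/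
theorem secondCase_of_ineq39 {D : B12Ineq39.Data39} (h : B12Ineq39.Ineq39Printed D) (hδ : 0 ≤ D.δ₀) (hd : 0 ≤ D.distX)
    (hM : 0 ≤ D.Minv) (hB : 0 ≤ D.B₃) (hf : 0 ≤ 2 * D.Ljη * D.normZH) : Ineq39SecondCasePrinted D := by
  unfold Ineq39SecondCasePrinted
  unfold B12Ineq39.Ineq39Printed at h
  have hexp : Real.exp (-(1 / 2 * D.δ₀ * D.distX) - 1 / 2 * D.δ₀ * D.Minv) ≤ 1 := by
    rw [Real.exp_le_one_iff]
    nlinarith [mul_nonneg hδ hd, mul_nonneg hδ hM]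
  calc D.lhs ≤ D.B₃ * Real.exp (-(1 / 2 * D.δ₀ * D.distX) - 1 / 2 * D.δ₀ * D.Minv) * (2 * D.Ljη * D.normZH) := h
    _ ≤ D.B₃ * 1 * (2 * D.Ljη * D.normZH) := by gcongr
    _ = D.B₃ * (2 * D.Ljη * D.normZH) := by ring

namespace Hyp

variable {𝓑 : Type*} [NormedAddCommGroup 𝓑] [NormedSpace ℝ 𝓑] {P : 𝓑 → ℝ} {SB : Set 𝓑} {C ε₁ : ℝ}
  {Φ : Type*} [NormedAddCommGroup Φ] [NormedSpace ℂ Φ] {spI_III : ℝ → ℝ → Set Φ} {α₀ α₁ : ℝ} {Pext : Φ → 𝓑 → ℂ} {bk : Φ}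
  {ι₃₉ : Type*} {D39 : ι₃₉ → B12Ineq39.Data39} {big : ι₃₉ → Prop}
  {ιG : Type*} {EA : ιG → Type*} [∀ g, NormedAddCommGroup (EA g)] [∀ g, NormedSpace ℂ (EA g)]
  {F : Type*} [NormedAddCommGroup F] [NormedSpace ℂ F] {α₂ : ℝ} {G : ∀ g, EA g → F} {E₀ κ : ℝ} {dX : ιG → ℝ}
  {T : Type*} {adm : ℝ → Set T} {termOf : T → ιG} {HjB : ∀ τ : T, EA (termOf τ)}
  {Sq EB 𝒰 𝒱 : Type*} {rep : Sq → EB → 𝒰} {rep0 : Sq → 𝒱 → 𝒰} {Mav : Sq → 𝒰 → 𝒱} {Dfl : Sq → Set EB}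
  {ι V EH : Type*} {Qavg : Sq → EH → ι → V} {Hj : Sq → (ι → V) → EH} {N4 : Sq → Set ι} {Bsq : Sq → Set (ι → V)}

/-- **p. 269 out of the bundle**: the one-constant quadratic bound of 𝐏^{(k)} in B. [cite: Balaban1987RG1, §3 p.269 ll.35–36 (bookkeeping)] -/
theorem pk_abs_le
    (h : Hyp P SB C ε₁ spI_III α₀ α₁ Pext bk D39 big EA α₂ G E₀ κ dX adm termOf HjB rep rep0 Mav Dfl Qavg Hj N4 Bsq)
    {B : 𝓑} (hB : B ∈ SB) : |P B| ≤ C * ε₁ * (1 + ‖B‖ + ‖B‖ ^ 2) :=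
  h.pkFluct.abs_le hB

/-- **(3.1) out of the bundle**, at the real pair. [cite: Balaban1987RG1, (3.1) p.269 (bookkeeping)] -/
theorem pkExt_restricts
    (h : Hyp P SB C ε₁ spI_III α₀ α₁ Pext bk D39 big EA α₂ G E₀ κ dX adm termOf HjB rep rep0 Mav Dfl Qavg Hj N4 Bsq)
    {B : 𝓑} (hB : B ∈ SB) : Pext bk B = (P B : ℂ) :=
  h.pkExt.restricts hB

/-- **(3.17) out of the bundle** (p. 273): below the ε₁-threshold of `eps1`, for every admissible far-term datum τ whose function (3.13)
is complex-differentiable on the (3.14)-set (`hG`, row B12.Eq3.13-3.14), every direction `δ𝐇_j ≠ 0` with the radius `r` of (3.15) and a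
(3.9)-type factor `s` (`‖δ𝐇_j‖ ≤ 2s`: the field `ineq39` ∕ `ineq39big` at the corresponding `Data39`, plus the derivative entries of
«and the same for derivatives …»), the t_□-derivative at 0 of (3.15) is bounded by `E₀e^{−κd_j(X)}·6α₂⁻¹·s` — the display (3.17) in
both cases of p. 273. [cite: Balaban1987RG1, (3.17) p.273 (bookkeeping)] -/
theorem bound317
    (h : Hyp P SB C ε₁ spI_III α₀ α₁ Pext bk D39 big EA α₂ G E₀ κ dX adm termOf HjB rep rep0 Mav Dfl Qavg Hj N4 Bsq)
    (hE₀ : 0 ≤ E₀) :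
    ∃ a > 0, ∀ ε : ℝ, 0 < ε → ε ≤ a → ∀ τ ∈ adm ε, ∀ (δH : EA (termOf τ)) (r s : ℝ),
      DifferentiableOn ℂ (G (termOf τ)) {A | ‖A‖ < α₂} → 0 < r → 0 < ‖δH‖ → r * ‖δH‖ = α₂ / 3 → ‖δH‖ ≤ 2 * s →
        ‖deriv (fun t : ℂ => G (termOf τ) (HjB τ + t • δH)) 0‖ ≤ E₀ * Real.exp (-(κ * dX (termOf τ))) * (6 * α₂⁻¹ * s) := by
  obtain ⟨a, ha, hε⟩ := h.eps1
  refine ⟨a, ha, fun ε hε0 hεa τ hτ δH r s hG hr hm hrad h39 => ?_⟩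
  exact _root_.Literature.MathematicalPhysics.QuantumFieldTheory.Balaban1983to89.B12Carve21Sect3ExpansionHyp.bound317
    hG (h.bound118 (termOf τ)) hE₀ (hε ε hε0 hεa τ hτ) hr hm hrad h39

/-- **(3.9) in the second-case shape at every first-case datum too** (bookkeeping for consumers that use one exponential-free majorant for
all terms): from `ineq39` and the signs of the named reals. [cite: Balaban1987RG1, (3.9) p.271, p.273 ll.19–22 (bookkeeping)] -/
theorem ineq39_noExp
    (h : Hyp P SB C ε₁ spI_III α₀ α₁ Pext bk D39 big EA α₂ G E₀ κ dX adm termOf HjB rep rep0 Mav Dfl Qavg Hj N4 Bsq)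
    {i : ι₃₉} (hcase : (D39 i).Minv ≤ (D39 i).distX) (hδ : 0 ≤ (D39 i).δ₀) (hM : 0 ≤ (D39 i).Minv) (hB : 0 ≤ (D39 i).B₃)
    (hf : 0 ≤ 2 * (D39 i).Ljη * (D39 i).normZH) : Ineq39SecondCasePrinted (D39 i) :=
  secondCase_of_ineq39 (h.ineq39 i hcase) hδ (hM.trans hcase) hM hB hf

/-- **(3.18) out of the bundle** at one occurring field: `U_j(exp iB_□ Ū^j_{k+1}) = U_j(□₀, M˙(U_j(exp iB_□ Ū^j_{k+1})))`.
[cite: Balaban1987RG1, (3.18) p.273 (bookkeeping)] -/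
theorem eq318_apply
    (h : Hyp P SB C ε₁ spI_III α₀ α₁ Pext bk D39 big EA α₂ G E₀ κ dX adm termOf HjB rep rep0 Mav Dfl Qavg Hj N4 Bsq)
    (σ : Sq) {B : EB} (hB : B ∈ Dfl σ) : rep σ B = rep0 σ (Mav σ (rep σ B)) :=
  B12NearTerms321.eq318_apply (h.eq318 σ) hB

/-- **What (3.21) uses of (3.20), out of the bundle**: with «ζ̃_□ = 0 outside □̃⁴» (`z = 0` off the neighbourhood `N4 σ` on which (3.20)
holds; `z` the values of ζ̃_□ at the bonds, in any normed field `𝕜` acting on the bond values), `ζ̃_□Q(ξ𝐇_j(B_□)) = ζ̃_□B_□` —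
`B12NearTerms321.mulFn_eq_of_eq320`. [cite: Balaban1987RG1, (3.20)–(3.21) p.274 (bookkeeping)] -/
theorem zetaTilde_mul_eq {𝕜 : Type*} [NontriviallyNormedField 𝕜] [NormedAddCommGroup V] [NormedSpace 𝕜 V]
    (h : Hyp P SB C ε₁ spI_III α₀ α₁ Pext bk D39 big EA α₂ G E₀ κ dX adm termOf HjB rep rep0 Mav Dfl Qavg Hj N4 Bsq)
    (σ : Sq) {b : ι → V} (hb : b ∈ Bsq σ) {z : ι → 𝕜} (hz : ∀ i ∉ N4 σ, z i = 0) :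
    B12NearTerms321.mulFn V z (Qavg σ (Hj σ b)) = B12NearTerms321.mulFn V z b :=
  B12NearTerms321.mulFn_eq_of_eq320 (h.eq320 σ b hb) hz

end Hyp

end Literature.MathematicalPhysics.QuantumFieldTheory.Balaban1983to89.B12Carve21Sect3ExpansionHyp
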